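import Summits.QuantumFields.YangMills.Theorems.BalabanUVNodesPortU8WindowLift

/-!
# PORT PT-B (U8), g3 file 9 — ★★★ THE WINDOW TRANSPORT LEMMA: under `NoWrapAt`, the push-forward by zero of the volume-`K` window critical configuration `H_D e_l` ([B6] (2.35))
# along the centred lift IS CRITICAL for the lifted window problem in volume `K + 1`, hence EQUALS `H_{D′} e_{l′}` by «exactly one critical configuration»
# (✓`existsUnique_isCritical_V1`); so `windowResp_{K+1} W′ l′ (lift b) = windowResp_K W l b` for EVERY fine bond `b` — [I] (1.21): the window problem does not see the volume

Cell `ym-nodeO-ideate` ∕ `ym-balaban-port`, porter `ymgap-nodeO-port-PTB-1` (gen 3), item **stmt-QuantumFields-27931** `BalabanUVNodes.PortPieceLocalityU8`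
(text ⁷⁗ «v10-Loc» `d796c7a1386a82f1`).  `--supports stmt-QuantumFields-27931` (helper).  [B6] = [Balaban1984PropagatorsII], [I] = [Balaban1987RG1].

WHAT THIS FILE PROVES (theorems only; no `def ∕ instance ∕ notation ∕ sorry`; standard axioms):
* ★★★ `isCritical_extend_liftBondCtr` — for `W = recordWindow F k K R z₀`, `W′` its twin in volume `K + 1`, `NoWrapAt F k K R z₀`, labels `l′ = (l₁, lift l₂)`: the push-forward
  `extend (liftBondCtr) (H_D e_l) 0` satisfies [B6]'s `IsCritical ∂ Q ∂* R e_{l′}` for `D′ = windowDomains (K+1) W′` — admissibility (`Q`: files 7–8; `R∂* = 0`: the pairing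
  `⟨Δn′, ∂*A′⟩` pulled back, file 8) and the vanishing first variation along every tangent direction (pull-back of tangent directions + `⟨∂A′, ∂v′⟩` pulled back, file 8);
* ★★★ `windowResp_liftBondCtr` — `windowResp F k (K+1) W′ l′ (liftBondCtr b) = windowResp F k K W l b` for every fine bond `b`.
HONEST FRAMING.  A lattice-geometry identity over r03's PROVED [B6] Sect. A uniqueness; the decay of the window response (the TokP9L4-Loc token) is NOT touched; nothing of
Bałaban's analysis asserted∕ported∕discharged; 27931 OPEN · SIGNED v10-Loc · close HOLD (№495); K0⁷ OPEN; NODE O 0∕1; COUNT 8∕28 · K 1∕4 UNMOVED; finite `𝕋⁴_{L^K}` at fixed ε —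
NOT continuum ∕ OS ∕ Clay; **the Yang–Mills mass gap (Clay) is NOT proved by any of this.**
-/

noncomputable section

open scoped BigOperators InnerProductSpace

namespace Summit.QuantumFields.YangMills.Theorems.PortU8

open Literature.MathematicalPhysics.QuantumFieldTheory.Balaban1983to89
open Literature.MathematicalPhysics.QuantumFieldTheory.Balaban1983to89.Node00
open Literature.MathematicalPhysics.QuantumFieldTheory.Balaban1983to89.T4Continuum (T4Family)
open Literature.MathematicalPhysics.QuantumFieldTheory.Balaban1983to89.B5Eq118OneStroke (iterBlockOf iterBlock)
open Literature.MathematicalPhysics.QuantumFieldTheory.Balaban1983to89.LatticeFieldCalculus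
open Literature.MathematicalPhysics.QuantumFieldTheory.Balaban1983to89.B6SectAOperatorsV1
open Literature.MathematicalPhysics.QuantumFieldTheory.Balaban1983to89.B6SectAVectorModelV1 (GE EE)
open Literature.MathematicalPhysics.QuantumFieldTheory.Balaban1983to89.B6SectACriticalPointV1 (isCritical_hOp_V1 isCritical_iff_eq_hOp)
open Literature.MathematicalPhysics.QuantumFieldTheory.Balaban1983to89.B6Eq218Lagrangian (IsCritical Admissible tangent mem_tangent_iff)
open Literature.MathematicalPhysics.QuantumFieldTheory.BalabanImbrieJaffe1984to88.BIJ85AxialPropagator411 (BondSpace PlaqSpace)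
open Summit.QuantumFields.YangMills.Theorems.K0RecordFormatNames

variable (F : T4Family) {k K R : ℕ} {z₀ : Fin 4 → ℤ}

/-- ★★★ **THE PUSH-FORWARD OF THE WINDOW CRITICAL CONFIGURATION IS CRITICAL IN THE BIGGER VOLUME.**  See the file header.
[cite: Balaban1984PropagatorsII, (2.5)–(2.6) p.224, (2.12) p.225, (2.35) p.228; Balaban1987RG1, (1.21) p.264, p.275 L5–8] -/
theorem isCritical_extend_liftBondCtr (hk : k + 1 ≤ F.m + K) (hnw : NoWrapAt F k K R z₀)
    (hkK : k + 1 ≤ (F.P K).m + (F.P K).K) (hkK' : k + 1 ≤ (F.P (K + 1)).m + (F.P (K + 1)).K)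
    (l : RespLabel F k K) (l' : RespLabel F k (K + 1)) (hl1 : (l'.1 : Fin 4) = l.1) (hl2 : l'.2 = liftSiteCtr F K (k + 1) l.2)
    {A : BondSpace (F.P K)}
    (hA : IsCritical (dcE 1) (QE (windowDomains F k K hkK (recordWindow F k K R z₀))) (dsE 1) (RE (windowDomains F k K hkK (recordWindow F k K R z₀)) 1)
      (windowSrc F k K hkK (recordWindow F k K R z₀) l) A) :
    IsCritical (dcE 1) (QE (windowDomains F k (K + 1) hkK' (recordWindow F k (K + 1) R z₀))) (dsE 1) (RE (windowDomains F k (K + 1) hkK' (recordWindow F k (K + 1) R z₀)) 1)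
      (windowSrc F k (K + 1) hkK' (recordWindow F k (K + 1) R z₀) l')
      (WithLp.toLp 2 (Function.extend (liftBondCtr F K 0) (WithLp.ofLp A) 0) : BondSpace (F.P (K + 1))) := by
  classical
  set W := recordWindow F k K R z₀ with hW
  set W' := recordWindow F k (K + 1) R z₀ with hW'
  set D := windowDomains F k K hkK W with hD
  set D' := windowDomains F k (K + 1) hkK' W' with hD'
  set A' : BondSpace (F.P (K + 1)) := WithLp.toLp 2 (Function.extend (liftBondCtr F K 0) (WithLp.ofLp A) 0) with hA'
  obtain ⟨⟨hQA, hRA⟩, hvarA⟩ := hA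
  obtain ⟨hA0, hAtop⟩ := (QE_windowDomains_eq_windowSrc_iff F hkK W l A).1 hQA
  have hAA : (fun b => WithLp.ofLp A' (liftBondCtr F K 0 b)) = WithLp.ofLp A := funext fun b => extend_liftBondCtr_apply F K _ b
  -- `A′` vanishes on the exterior–exterior bonds of the lifted window
  have hA'0 : ∀ b' : PBond (F.P (K + 1)) 0, iterBlockOf (k + 1) b'.src ∉ W' → iterBlockOf (k + 1) b'.tgt ∉ W' → WithLp.ofLp A' b' = 0 := by
    intro b' hs ht
    show Function.extend (liftBondCtr F K 0) (WithLp.ofLp A) 0 b' = 0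
    by_cases hr : b' ∈ Set.range (liftBondCtr F K 0)
    · obtain ⟨b, rfl⟩ := hr
      rw [extend_liftBondCtr_apply]
      obtain ⟨hs0, ht0⟩ := extExt_of_liftBondCtr F hk hnw hs ht
      exact hA0 b hs0 ht0
    · exact extend_liftBondCtr_of_not_mem_range F K _ hr
  -- the label bonds correspond
  have hlab : ∀ c : PBond (F.P K) (k + 1), (c = ⟨l.2, l.1⟩ ↔ liftBondCtr F K (k + 1) c = ⟨l'.2, l'.1⟩) := by
    intro c
    constructor
    · rintro rfl
      show (⟨liftSiteCtr F K (k + 1) l.2, l.1⟩ : PBond (F.P (K + 1)) (k + 1)) = ⟨l'.2, l'.1⟩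
      rw [hl2]; congr 1; exact hl1.symm
    · intro h
      have hs : liftSiteCtr F K (k + 1) c.src = l'.2 := congrArg PBond.src h
      have hd : (c.dir : Fin 4) = l'.1 := congrArg PBond.dir h
      rw [hl2] at hs
      have := liftSiteCtr_injective F K (k + 1) hk hs
      cases c; simp only at this hd ⊢; subst this; rw [hd, hl1]
  refine ⟨⟨?_, ?_⟩, ?_⟩
  · -- (a) `QA′ = e_{l′}`
    rw [QE_windowDomains_eq_windowSrc_iff]
    refine ⟨hA'0, fun c' hc' => ?_⟩
    obtain ⟨c, hc, rfl⟩ := exists_coarse_lift_of_touch F hk hnw hc'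
    rw [show WithLp.ofLp A' = Function.extend (liftBondCtr F K 0) (WithLp.ofLp A) 0 from rfl, bondAvgIter_extend_liftBondCtr F hk hnw hc, hAtop c hc]
    by_cases hcl : c = ⟨l.2, l.1⟩
    · rw [if_pos hcl, if_pos ((hlab c).1 hcl)]
    · rw [if_neg hcl, if_neg (fun h => hcl ((hlab c).2 h))]
  · -- (b) `R∂*A′ = 0`
    rw [RE_eq_zero_iff]
    intro n' hn'
    have hn := comp_lift_mem_ker_QpE F hk hnw hkK hkK' hn'
    have h0 := (RE_eq_zero_iff D 1 (dsE 1 A)).1 hRA _ hn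
    rw [inner_eq_sum] at h0 ⊢
    simp only [lapE_apply, dsE_apply] at h0 ⊢
    rw [sum_laplace_mul_diverg_lift F hk hnw 1 (n' := WithLp.ofLp n') ((mem_ker_QpE_windowDomains_iff F hkK' W' n').1 hn').1 (WithLp.ofLp A'), hAA]
    exact h0
  · -- (c) the first variation vanishes along every tangent direction
    intro v' hv'
    obtain ⟨hQv', hRv'⟩ := (mem_tangent_iff _ _ _ v').1 hv'
    set v : BondSpace (F.P K) := WithLp.toLp 2 fun b => WithLp.ofLp v' (liftBondCtr F K 0 b) with hv
    have hvt : v ∈ tangent (QE D) (dsE 1) (RE D 1) := by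
      rw [mem_tangent_iff]
      obtain ⟨h0', htop'⟩ := (QE_windowDomains_eq_zero_iff F hkK' W' v').1 hQv'
      constructor
      · rw [QE_windowDomains_eq_zero_iff]
        refine ⟨fun b hs ht => ?_, fun c hc => ?_⟩
        · obtain ⟨hs', ht'⟩ := extExt_liftBondCtr F hk hnw hs ht
          exact h0' _ hs' ht'
        · rw [show WithLp.ofLp v = fun b => WithLp.ofLp v' (liftBondCtr F K 0 b) from rfl, bondAvgIter_comp_liftBondCtr F hk hnw hc]
          exact htop' _ (touch_liftBondCtr F hk hnw hc).1
      · rw [RE_eq_zero_iff]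
        intro n hn
        have hn' := extend_mem_ker_QpE F hk hnw hkK hkK' hn
        have h0 := (RE_eq_zero_iff D' 1 (dsE 1 v')).1 hRv' _ hn'
        rw [inner_eq_sum] at h0 ⊢
        simp only [lapE_apply, dsE_apply] at h0 ⊢
        rw [sum_laplace_mul_diverg_lift F hk hnw 1 ((mem_ker_QpE_windowDomains_iff F hkK' W' _).1 hn').1 (WithLp.ofLp v')] at h0
        have hnn : (fun t => WithLp.ofLp (WithLp.toLp 2 (Function.extend (liftSiteCtr F K 0) (WithLp.ofLp n) 0) : ScalarSpace (F.P (K + 1))) (liftSiteCtr F K 0 t)) = WithLp.ofLp n :=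
          funext fun t => extend_liftSiteCtr_apply F K _ t
        rw [hnn] at h0
        exact h0
    have h0 := hvarA v hvt
    rw [inner_eq_sum] at h0 ⊢
    simp only [dcE_apply] at h0 ⊢
    rw [sum_curl_mul_curl_lift F hk hnw 1 hA'0 (WithLp.ofLp v'), hAA]
    exact h0

/-- ★★★ **THE WINDOW RESPONSE DOES NOT SEE THE VOLUME**: under `NoWrapAt F k K R z₀`, for labels `l′ = (l₁, lift l₂)` and every fine bond `b` of `T_K`,
`windowResp F k (K+1) (recordWindow (K+1) R z₀) l′ (lift b) = windowResp F k K (recordWindow K R z₀) l b`. [cite: Balaban1987RG1, (1.21) p.264, p.275 L5–8; Balaban1984PropagatorsII, (2.35) p.228] -/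
theorem windowResp_liftBondCtr (hk : k + 1 ≤ F.m + K) (hnw : NoWrapAt F k K R z₀) (l : RespLabel F k K) (l' : RespLabel F k (K + 1))
    (hl1 : (l'.1 : Fin 4) = l.1) (hl2 : l'.2 = liftSiteCtr F K (k + 1) l.2) (b : PBond (F.P K) 0) :
    windowResp F k (K + 1) (recordWindow F k (K + 1) R z₀) l' (liftBondCtr F K 0 b) = windowResp F k K (recordWindow F k K R z₀) l b := by
  classical
  have hkK : k + 1 ≤ (F.P K).m + (F.P K).K := by simpa using hk
  have hkK' : k + 1 ≤ (F.P (K + 1)).m + (F.P (K + 1)).K := by simp only [T4Family.P_m, T4Family.P_K]; omega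
  unfold windowResp
  rw [dif_pos hkK', dif_pos hkK]
  set D := windowDomains F k K hkK (recordWindow F k K R z₀) with hD
  set D' := windowDomains F k (K + 1) hkK' (recordWindow F k (K + 1) R z₀) with hD'
  set A := B6SectA.hOp (GE D (one_ne_zero (α := ℝ)) (w := fun _ => (1 : ℝ)) fun _ => one_pos) (QsE D)
    (EE D (one_ne_zero (α := ℝ)) (w := fun _ => (1 : ℝ)) fun _ => one_pos) (windowSrc F k K hkK (recordWindow F k K R z₀) l) with hA
  have hcrit : IsCritical (dcE 1) (QE D) (dsE 1) (RE D 1) (windowSrc F k K hkK (recordWindow F k K R z₀) l) A :=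
    isCritical_hOp_V1 D one_ne_zero (fun _ => one_pos) _
  have hcrit' := isCritical_extend_liftBondCtr F hk hnw hkK hkK' l l' hl1 hl2 hcrit
  have hEq := (isCritical_iff_eq_hOp D' (one_ne_zero (α := ℝ)) (w := fun _ => (1 : ℝ)) (fun _ => one_pos) _ _).1 hcrit'
  rw [← hEq]
  exact extend_liftBondCtr_apply F K _ b

end Summit.QuantumFields.YangMills.Theorems.PortU8

end
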